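import Summits.PneNP.PneNP.Theses.PhaseTwins
import Literature.Computability.Complexity.HardcoreInapproximability
import Literature.Computability.Complexity.ClockedUniversalAcceptance
import Literature.Computability.Cryptography.OneWayFunctions
import Literature.Computability.Cryptography.Indistinguishability
import Literature.Computability.MetaComplexity.HeuristicClasses

/-!
# Sketch — crux-ideate stmt-PneNP-2721 (PseudorandomTwinsAbove), ideator 3 (gen 2), round 1

First lemmas (signatures; `sorry` bodies allowed) of three crux idea cards:

* Card U `universal-horizon-twins` — completeness of the brute-force horizon sampler:
  `PseudorandomTwinsAbove ⟺ limsup W = ∞`; kernel = AVERAGE-CASE sparsification of a min-max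
  separator against the hypothetical twins (`exists_sparse_separator`).
* Card H `hardcore-density-heuristica` — Impagliazzo's density-restricted min-max, two-sided:
  dense twins or an O(1)-sparse average-case separator (`denseTwins_or_avgSeparator`); with a
  deterministic bounded-degree GapIS transport this puts the typed crux below
  `DistNP ⊄ Heur_δBPP/log`.
* Card A `alpha-corner-fglss-transport` — at activity `λ ≥ 2^{(n+3)/gap}` the hard-core count is a
  proxy for the independence number (`countGap_of_alphaGap`, sandwich `λ^α ≤ Z ≤ 2ⁿλ^α`), so
  bounded-degree GapIS twins (PCP image of any PRG) are hard-core twins: `OWFExist ⇒ crux` with a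
  deterministic, gadget-free transport (`crux_of_owf_shape`).
-/

set_option linter.dupNamespace false

namespace Summit.PneNP.PneNP.Cruxes.PseudorandomTwinsAbove.Ideator3g2

open Filter Finset
open Literature.Computability.Complexity Literature.Computability.MetaComplexity
open Literature.Probability.LatticeModels Computability
open scoped Classical

noncomputable section

/-- Clause (i) of the crux, verbatim (index-free PPT tests, coin length = free advice). -/
def IndexFreeIndist (D₀ D₁ : Ensemble) : Prop :=
  ∀ A : RandAlg (List Bool) Bool, A.IsPolyTime (id : List Bool → List Bool) encodeBool →
    Tendsto (fun n : ℕ => |(∑' x : List Bool, ((D₀ n) x).toReal * A.pr id x {b | b = true}) -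
      (∑' x : List Bool, ((D₁ n) x).toReal * A.pr id x {b | b = true})|) atTop (nhds 0)

/-- Clause (ii) of the crux for an abstract count `N` and threshold sequence `t`. -/
def CountSeparated (D₀ D₁ : Ensemble) (N : List Bool → ℕ) (t : ℕ → ℕ) : Prop :=
  Tendsto (fun n : ℕ => D₀.prob n {x | 8 * t n ≤ N x}) atTop (nhds 1) ∧
    Tendsto (fun n : ℕ => D₁.prob n {x | 0 < N x ∧ N x ≤ t n}) atTop (nhds 1)

/-- The crux from abstract witnesses (bookkeeping target shared by all three cards). -/
theorem crux_of_witnesses {Δ p q : ℕ} (hΔ : 3 ≤ Δ) (hq : 0 < q)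
    (hlam : hardCoreThreshold Δ < (p : ℝ) / q) (D₀ D₁ : Ensemble)
    (hs₀ : D₀.IsPolySamplable) (hs₁ : D₁.IsPolySamplable) (hi : IndexFreeIndist D₀ D₁)
    (t : ℕ → ℕ) (hii : CountSeparated D₀ D₁ (hardcoreCount Δ p q) t) :
    Summit.PneNP.PneNP.Theses.PhaseTwins.PseudorandomTwinsAbove := by
  sorry

/-! ## Card U — universal horizon twins: the sparsification kernel of `crux ⇒ limsup W = ∞`

A worst-case margin separator `h = Σ_j q_j s_j g_j` (from min-max at one scale) is replaced by the
average of `R = O(log(1/δ)/ε²)` sampled signed tests; it keeps the margin `ε/2` outside sets of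
`P`-mass and `Q`-mass `≤ δ`, where `P`, `Q` are the (arbitrary!) conditional laws of the
HYPOTHETICAL twins at that scale. `R = O(1)` descriptors fit into the `O(log ℓ)`-bit coin-length
channel (`Disproof.isPolyTime_coinLen_irrelevant`), which is why the separator becomes ONE typed
test. Pattern: `HardCoreMinMax.exists_majority_sample` with weights in place of counting. -/
theorem exists_sparse_separator {Ω J : Type*} [Fintype Ω] [Fintype J] [Nonempty J]
    (g : J → Ω → ℝ) (hg : ∀ j x, 0 ≤ g j x ∧ g j x ≤ 1)
    (q : J → ℝ) (hq : ∀ j, 0 ≤ q j) (hq1 : ∑ j, q j = 1) (s : J → ℝ) (hs : ∀ j, s j = 1 ∨ s j = -1)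
    (θ ε : ℝ) (hε : 0 < ε) (H L : Finset Ω)
    (hH : ∀ x ∈ H, θ + ε ≤ ∑ j, q j * (s j * g j x))
    (hL : ∀ x ∈ L, ∑ j, q j * (s j * g j x) ≤ θ - ε)
    (P Q : Ω → ℝ) (hP : ∀ x, 0 ≤ P x) (hQ : ∀ x, 0 ≤ Q x)
    (hP1 : ∑ x ∈ H, P x ≤ 1) (hQ1 : ∑ x ∈ L, Q x ≤ 1)
    (δ : ℝ) (hδ : 0 < δ) (R : ℕ) (hR0 : 0 < R) (hR : 8 * Real.exp (-((R : ℝ) * ε ^ 2 / 8)) ≤ δ) :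
    ∃ a : Fin R → J,
      (∑ x ∈ H.filter (fun x => (∑ i, s (a i) * g (a i) x) / R < θ + ε / 2), P x) ≤ δ ∧
      (∑ x ∈ L.filter (fun x => θ - ε / 2 < (∑ i, s (a i) * g (a i) x) / R), Q x) ≤ δ := by
  sorry

/-! ## Card H — hard-core density: dense twins or an average-case sparse separator

Two-sided Impagliazzo game at one scale: Player 1 plays pairs `(μ₀, μ₁)` supported in `H`/`L` and
`δ`-DENSE in the reference weights `U|H`, `U|L`; Player 2 plays signed tests. Either `ε`-twins
exist among dense pairs, or a mixture `h` has margin `ε/4` around a threshold `θ` outside sets of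
relative `U`-mass `< δ` on each side (then `exists_sparse_separator` with `P = U|H`, `Q = U|L`
makes it `O(1)`-sparse). One application of `MinMax.exists_mixed_of_forall_mixed` on the polytope
of dense pairs (its vertices), exactly as in `HardCoreMinMax.exists_hardCore_measure`. -/
theorem denseTwins_or_avgSeparator {Ω T : Type*} [Fintype Ω] [Fintype T] [Nonempty T]
    (f : T → Ω → ℝ) (hf : ∀ t x, 0 ≤ f t x ∧ f t x ≤ 1) (H L : Finset Ω) (hHL : Disjoint H L)
    (U : Ω → ℝ) (hU : ∀ x, 0 ≤ U x) (hUH : 0 < ∑ x ∈ H, U x) (hUL : 0 < ∑ x ∈ L, U x)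
    (δ ε : ℝ) (hδ : 0 < δ) (hδ1 : δ ≤ 1) (hε : 0 < ε) :
    (∃ μ₀ μ₁ : Ω → ℝ,
      (∀ x, 0 ≤ μ₀ x ∧ μ₀ x ≤ U x / (δ * ∑ y ∈ H, U y)) ∧ (∀ x, x ∉ H → μ₀ x = 0) ∧ ∑ x, μ₀ x = 1 ∧
      (∀ x, 0 ≤ μ₁ x ∧ μ₁ x ≤ U x / (δ * ∑ y ∈ L, U y)) ∧ (∀ x, x ∉ L → μ₁ x = 0) ∧ ∑ x, μ₁ x = 1 ∧
      ∀ t, |∑ x, μ₀ x * f t x - ∑ x, μ₁ x * f t x| ≤ ε) ∨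
    (∃ (q : T × Bool → ℝ) (θ : ℝ), (∀ j, 0 ≤ q j) ∧ ∑ j, q j = 1 ∧
      (∑ x ∈ H.filter (fun x => (∑ j, q j * ((if j.2 then (1 : ℝ) else -1) * f j.1 x)) ≤ θ + ε / 4), U x)
          < δ * ∑ x ∈ H, U x ∧
      (∑ x ∈ L.filter (fun x => θ - ε / 4 ≤ ∑ j, q j * ((if j.2 then (1 : ℝ) else -1) * f j.1 x)), U x)
          < δ * ∑ x ∈ L, U x) := by
  sorry

/-- Encoder for index-fed heuristics WITH an advice string: `⟨x, ⟨1ⁿ, a⟩⟩`. -/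
def advEnc : List Bool × ℕ × List Bool → List Bool := fun q =>
  boolPair q.1 (boolPair (unaryEncodeNat q.2.1) q.2.2)

/-- `Heur_δ BPP / (c log n + c)`: the tree's `HeurDeltaBPP δ` with `c·log₂ n + c` bits of advice
(the advice mirrors the coin-length channel of the crux's tests). -/
def HeurDeltaBPPLog (δ : ℝ) (c : ℕ) : Set DistProblem :=
  {Q | ∃ (A : RandAlg (List Bool × ℕ × List Bool) Bool) (adv : ℕ → List Bool),
    A.IsPolyTime advEnc encodeBool ∧ (∀ n, (adv n).length ≤ c * Nat.log 2 n + c) ∧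
    ∀ n, Q.dist.prob n {x | 1 / 4 ≤ A.pr advEnc (x, n, adv n) {b | b ≠ Q.lang.boolIndicator x}} ≤ δ}

/-- Card H's load-bearing hypothesis (¬Heuristica for log-advised randomized heuristics, constant
error): some `DistNP` problem is outside `Heur_δ BPP/log` for some `δ > 0` and every advice rate.
Pessiland-compatible; not known to imply or to follow from `NP ⊄ P/poly`. -/
def NPMildlyHardOnAverageLog : Prop :=
  ∃ Q ∈ DistNP, ∃ δ : ℝ, 0 < δ ∧ ∀ c : ℕ, Q ∉ HeurDeltaBPPLog δ c

/-! ## Card A — the α-corner transport (FGLSS at exponentially large activity) -/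

/-- SANDWICH at `λ ≥ 1`: `λ^{α(G)} ≤ Z_G(λ) ≤ 2ⁿ λ^{α(G)}` (one maximum independent set from below;
`2ⁿ` sets each of weight `≤ λ^α` from above). [folklore; AtseriasDawar2019 §5 use] -/
theorem indepPoly_sandwich {n : ℕ} (G : SimpleGraph (Fin n)) {lam : ℝ} (hlam : 1 ≤ lam) :
    lam ^ G.indepNum ≤ independencePolynomial G lam ∧
      independencePolynomial G lam ≤ 2 ^ n * lam ^ G.indepNum := by
  sorry

/-- COUNT GAP FROM AN α-GAP: if `α(G) ≥ K₁`, `α(H) ≤ K₀` and `8 · 2ⁿ · λ^{K₀} ≤ λ^{K₁}` (e.g.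
`λ = 2^{⌈(n+3)/(K₁-K₀)⌉}`, a CONSTANT when the gap `K₁ - K₀` is linear in `n`), then
`Z_G(λ) ≥ 8 · Z_H(λ)`: the factor-8 separation of clause (ii) with the deterministic threshold
`t = 2ⁿ λ^{K₀}` (times `qⁿ` for `hardcoreCount`). -/
theorem countGap_of_alphaGap {n : ℕ} (G H : SimpleGraph (Fin n)) {lam : ℝ} (hlam : 1 ≤ lam)
    {K₀ K₁ : ℕ} (hG : K₁ ≤ G.indepNum) (hH : H.indepNum ≤ K₀)
    (hsep : 8 * 2 ^ n * lam ^ K₀ ≤ lam ^ K₁) :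
    8 * independencePolynomial H lam ≤ independencePolynomial G lam := by
  sorry

/-- The named fact Card A (and Card H) want vendored: NP-hardness of GAP INDEPENDENT SET on
bounded-degree graphs under deterministic Karp reductions (PCP theorem + Papadimitriou–Yannakakis
MAX-SNP-hardness of MIS-B / FGLSS on bounded-occurrence gap-3SAT; explicit: Berman–Karpinski 1999
Thm 1(v), 3-MIS within 140/139). Shape normalisation (vertex count a function of `|y|` only) is a
separate elementary padding lemma (disjoint copies + isolated vertices), not part of the fact. -/
def BoundedDegreeGapIS_isNPHard : Prop :=
  ∃ (Δ₀ : ℕ) (a b : ℚ), 0 < b ∧ b < a ∧ ∀ L ∈ Nondeterministic.NP, ∃ f : List Bool → List Bool,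
    PolyTimeComputable (id : List Bool → List Bool) (id : List Bool → List Bool) f ∧
    ∀ y : List Bool, ∃ (n : ℕ) (G : SimpleGraph (Fin n)), f y = encodingGraph.encode ⟨n, G⟩ ∧
      G.maxDegree ≤ Δ₀ ∧ (y ∈ L → (a : ℝ) * n ≤ G.indepNum) ∧ (y ∉ L → (G.indepNum : ℝ) ≤ b * n)

/-- Card A end-to-end shape: `OWF ⇒ crux`, deterministic transport. Chain: `OWFExist ⇒ PRGExist`
(`PRGExist_of_OWFExist`, PROVED) ⇒ the NP language `Im G ∩ {0,1}^{ℓ n}` vs uniform strings ⇒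
bounded-degree GapIS codes of a FIXED vertex count `V(n)` (fact + padding) ⇒ at
`λ = p/1 ≥ 2^{⌈(1+3/V)/(a-b')⌉}` the sandwich gives `N ≥ 8t` surely on the image side and
`0 < N ≤ t` with probability `≥ 1 - 2^{n-ℓ n}` on the uniform side (`countGap_of_alphaGap`);
indistinguishability by FP post-processing (`IsCompIndistinguishable.map_fp`) ⇒ clause (i). -/
theorem crux_of_owf_shape (hGap : BoundedDegreeGapIS_isNPHard)
    (hOWF : Literature.Computability.Cryptography.OWFExist) :
    Summit.PneNP.PneNP.Theses.PhaseTwins.PseudorandomTwinsAbove := by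
  sorry

/-- Card H end-to-end shape: typed crux from mild average-case hardness of NP for log-advised
heuristics, through the universal clocked simulation (tests are simulated at tiny scale), the
bounded-degree GapIS fact (a DETERMINISTIC transport keeps the separator uniform) and the two
kernels above. -/
theorem crux_of_heuristica_fails_shape (hU : clockedUniversalAcceptance)
    (hGap : BoundedDegreeGapIS_isNPHard) (hH : NPMildlyHardOnAverageLog) :
    Summit.PneNP.PneNP.Theses.PhaseTwins.PseudorandomTwinsAbove := by
  sorry

end

end Summit.PneNP.PneNP.Cruxes.PseudorandomTwinsAbove.Ideator3g2
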